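import Literature.Computability.Complexity.TimeBounds
import Mathlib.Algebra.Polynomial.Basic
import Mathlib.Algebra.Polynomial.Eval.Defs
import Mathlib.Data.Fintype.Sum
import Mathlib.Data.Fintype.Prod
import Mathlib.Data.Finset.Lattice.Fold
import HarnessLib

/-!
# Composition of (polynomial-)time computable functions in Mathlib's TM2 model

Sibling proof file of `TimeBounds.lean` (D-0014: named facts `def X : Prop` are discharged as
`theorem X_holds : X`). It discharges

* `Literature.CplxCore.PolyTimeComputable.comp_holds : PolyTimeComputable.comp` — composition of
  polynomial-time computable functions is polynomial-time computable; this is Mathlib's open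
  `proof_wanted Turing.TM2ComputableInPolyTime.comp` (restated and proved as
  `Literature.Computability.Complexity.nonempty_tm2ComputableInPolyTime_comp`);
* `Literature.CplxCore.TimeComputable.comp_holds : TimeComputable.comp` — the time-bounded version
  (with constant `c = 1`).

Source: Arora–Barak, *Computational Complexity: A Modern Approach* (2009). The printed argument
is the proof of Thm. 2.8 (transitivity of `≤ₚ`, book §2.2): "if `p`, `q` grow at most as `n^c`,
`n^d`, then `p(q(n))` grows as at most `n^{cd}` … the mapping `x ↦ f₂(f₁(x))` … takes polynomial
time to compute given `x`", the machine being the sequential composition of §1.3 (run the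
first machine, feed its output to the second). No step of this is in Mathlib beyond the
definitions; this file supplies the machine and the bookkeeping.

## The construction (`TM2Comp.compTM`)

Given bundled machines `M₁ M₂ : Turing.FinTM2` and an identification
`e : M₁.Γ M₁.k₁ ≃ M₂.Γ M₂.k₀` of the output alphabet of `M₁` with the input alphabet of `M₂`,
the composite machine has stacks `K₁ ⊕ K₂` with alphabets `CompΓ = Sum.elim Γ¹ Γ²`, labels
`Λ₁ ⊕ Λ₂`, states `σ₁ × σ₂`, input stack `inl k₀¹`. **No copying phase is needed:** the input
stack `k₀²` of `M₂` is *redirected* (`TM2Comp.redirect`) onto the physical stack `inl k₁¹`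
holding the output of `M₁` (symbols read and written through `e`), the stack `inr k₀²` staying
unused; the `halt` of `M₁` is translated to `goto main₂`. Consequently the running times simply
add (`Turing.TM2ComputableAux.comp_outputsWithin`: `m₁` steps then `m₂` steps), and Mathlib's
exact halting convention (`Turing.haltList`: all other stacks empty, state reset) is met because
`M₁` halts in `haltList` form and `M₂` starts from `initList` form.

## Proof architecture

1. `TM2Comp.iterate_bind_map`: an `n`-step run `(flip bind f)^[n] (some c) = some d` is
   transported along any map commuting with single steps; `TM2Comp.iterate_bind_le`: a quantity
   growing by `≤ D` per step grows by `≤ D * n`.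
2. `TM2Comp.stepAux_trStmt₁`, `TM2Comp.stepAux_trStmt₂`: one translated statement of `M₁`
   (resp. `M₂`) acts on embedded configurations `cfg₁` (resp. `cfg₂`) exactly as the original
   (induction on `TM2.Stmt`; the stack bookkeeping is `stk₁_update`, `stk₂_redirect`,
   `stk₂_update`, phrased with `Function.update`).
3. `TM2Comp.initList_eq`, `TM2Comp.haltList_eq`: Mathlib's `initList`/`haltList` are single
   `Function.update`s of the empty stack assignment; whence the three gluing identities
   `cfg₁_initList`, `cfg₁_haltList` (end of phase 1 = start of phase 2), `cfg₂_haltList`.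
4. `TM2Comp.length_le_of_outputsWithin`: an output produced within `m` steps has length
   `≤ l.length + D * m`, `D = machinePushBound` (a statement pushes at most `pushBound` symbols
   on each stack, `length_stepAux_le`; finitely many labels).
5. `PolyTimeComputable.comp_holds`: time `p₂ (n + D * p₁ n) + p₁ n`, a polynomial
   (`Polynomial.comp`), using monotonicity of evaluation of `ℕ`-polynomials.

## References

* S. Arora, B. Barak, *Computational Complexity: A Modern Approach*, CUP 2009, §1.3 (machine
  constructions), Thm. 2.8 and its proof (composition of polynomial-time computable maps).
* Mathlib, `Mathlib/Computability/TuringMachine/Computable.lean`,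
  `proof_wanted Turing.TM2ComputableInPolyTime.comp`.
-/

namespace Literature.Computability.Complexity.TM2Comp

open Turing StateTransition Function

/-! ### Iterating a partial step function -/

section Iterate

variable {σ σ' : Type*}

/-- A halted run stays halted: iterating the lifted step function on `none` gives `none`. [folklore]
-/
theorem iterate_bind_none (f : σ → Option σ) (n : ℕ) :
    (flip bind f)^[n] (none : Option σ) = none := by
  induction n with
  | zero => rfl
  | succ n ih => rw [iterate_succ_apply]; exact ih

/-- One more step of an iterated partial step function, unfolded at the head. [folklore] -/
theorem iterate_bind_succ (f : σ → Option σ) (n : ℕ) (c : σ) :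
    (flip bind f)^[n + 1] (some c) = (flip bind f)^[n] (f c) := by
  rw [iterate_succ_apply]; rfl

/-- Transport of an `n`-step run along a map `τ` commuting with single steps. [folklore] -/
theorem iterate_bind_map (f : σ → Option σ) (g : σ' → Option σ') (τ : σ → σ')
    (H : ∀ c d, f c = some d → g (τ c) = some (τ d)) (n : ℕ) :
    ∀ c d, (flip bind f)^[n] (some c) = some d →
      (flip bind g)^[n] (some (τ c)) = some (τ d) := by
  induction n with
  | zero =>
    intro c d h
    simp only [iterate_zero, id_eq, Option.some.injEq] at h
    simp [h]
  | succ n ih =>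
    intro c d h
    rw [iterate_bind_succ] at h ⊢
    cases hfc : f c with
    | none => rw [hfc, iterate_bind_none] at h; cases h
    | some c' => rw [hfc] at h; rw [H c c' hfc]; exact ih c' d h

/-- Induction along an `n`-step run for a quantity that grows by at most `D` per step. [folklore] -/
theorem iterate_bind_le (f : σ → Option σ) (φ : σ → ℕ) (D : ℕ)
    (H : ∀ c d, f c = some d → φ d ≤ φ c + D) (n : ℕ) :
    ∀ c d, (flip bind f)^[n] (some c) = some d → φ d ≤ φ c + D * n := by
  induction n with
  | zero =>
    intro c d h
    simp only [iterate_zero, id_eq, Option.some.injEq] at h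
    simp [h]
  | succ n ih =>
    intro c d h
    rw [iterate_bind_succ] at h
    cases hfc : f c with
    | none => rw [hfc, iterate_bind_none] at h; cases h
    | some c' =>
      rw [hfc] at h
      have h1 := H c c' hfc
      have h2 := ih c' d h
      rw [Nat.mul_succ]
      omega

end Iterate

/-! ### Stack growth per step -/

section PushBound

variable {K : Type} {Γ : K → Type} {Λ σ : Type}

/-- The maximal number of `push` instructions along an execution path of a TM2 statement.
[folklore] -/
def pushBound : TM2.Stmt Γ Λ σ → ℕ
  | TM2.Stmt.push _ _ q => pushBound q + 1
  | TM2.Stmt.peek _ _ q => pushBound q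
  | TM2.Stmt.pop _ _ q => pushBound q
  | TM2.Stmt.load _ q => pushBound q
  | TM2.Stmt.branch _ q₁ q₂ => max (pushBound q₁) (pushBound q₂)
  | TM2.Stmt.goto _ => 0
  | TM2.Stmt.halt => 0

variable [DecidableEq K]

/-- Pushing one symbol on stack `k'` lengthens any stack `k` by at most one. [folklore] -/
theorem length_update_cons_le (S : ∀ k, List (Γ k)) (k' k : K) (x : Γ k') :
    (update S k' (x :: S k') k).length ≤ (S k).length + 1 := by
  rcases eq_or_ne k k' with rfl | h
  · simp
  · rw [update_of_ne h]; exact Nat.le_succ _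

/-- Popping stack `k'` does not lengthen any stack. [folklore] -/
theorem length_update_tail_le (S : ∀ k, List (Γ k)) (k' k : K) :
    (update S k' (S k').tail k).length ≤ (S k).length := by
  rcases eq_or_ne k k' with rfl | h
  · simp
  · rw [update_of_ne h]

/-- Executing one statement lengthens each stack by at most `pushBound` symbols. [folklore] -/
theorem length_stepAux_le (q : TM2.Stmt Γ Λ σ) (v : σ) (S : ∀ k, List (Γ k)) (k : K) :
    ((TM2.stepAux q v S).stk k).length ≤ (S k).length + pushBound q := by
  induction q generalizing v S with
  | push k' f q ih =>
    simp only [TM2.stepAux, pushBound]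
    exact (ih _ _).trans (by have := length_update_cons_le S k' k (f v); omega)
  | peek k' f q ih => simp only [TM2.stepAux, pushBound]; exact ih _ _
  | pop k' f q ih =>
    simp only [TM2.stepAux, pushBound]
    exact (ih _ _).trans (by have := length_update_tail_le S k' k; omega)
  | load f q ih => simp only [TM2.stepAux, pushBound]; exact ih _ _
  | branch p q₁ q₂ ih₁ ih₂ =>
    simp only [TM2.stepAux, pushBound]
    cases p v
    · exact (ih₂ _ _).trans (by have := le_max_right (pushBound q₁) (pushBound q₂); omega)
    · exact (ih₁ _ _).trans (by have := le_max_left (pushBound q₁) (pushBound q₂); omega)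
  | goto l => simp [TM2.stepAux, pushBound]
  | halt => simp [TM2.stepAux, pushBound]

end PushBound

/-- A uniform bound on the number of pushes performed by one step of a `FinTM2`. [folklore] -/
noncomputable def machinePushBound (tm : FinTM2) : ℕ :=
  letI := tm.ΛFin
  Finset.univ.sup fun l => pushBound (tm.m l)

/-- One step of a `FinTM2` lengthens each stack by at most `machinePushBound` symbols. [folklore] -/
theorem length_step_le (tm : FinTM2) (c d : tm.Cfg) (h : tm.step c = some d) (k : tm.K) :
    (d.stk k).length ≤ (c.stk k).length + machinePushBound tm := by
  letI := tm.ΛFin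
  obtain ⟨_ | l, v, S⟩ := c
  · simp [FinTM2.step, TM2.step] at h
  · simp only [FinTM2.step, TM2.step] at h
    obtain rfl := Option.some.inj h
    refine (length_stepAux_le _ _ _ _).trans (Nat.add_le_add_left ?_ _)
    exact Finset.le_sup (f := fun l => pushBound (tm.m l)) (Finset.mem_univ l)

/-- `n` steps of a `FinTM2` lengthen each stack by at most `machinePushBound * n` symbols.
[folklore] -/
theorem length_iterate_le (tm : FinTM2) (k : tm.K) (n : ℕ) (c d : tm.Cfg)
    (h : (flip bind tm.step)^[n] (some c) = some d) :
    (d.stk k).length ≤ (c.stk k).length + machinePushBound tm * n :=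
  iterate_bind_le tm.step (fun c => (c.stk k).length) (machinePushBound tm)
    (fun c d hcd => length_step_le tm c d hcd k) n c d h

/-! ### `initList` / `haltList` as single-stack updates -/

section InitHalt

/-- A single-stack assignment has, on every stack, length at most that of the assigned word.
[folklore] -/
theorem length_update_bot_le {K : Type} [DecidableEq K] {Γ : K → Type} (a k : K)
    (L : List (Γ a)) : (update (fun j => ([] : List (Γ j))) a L k).length ≤ L.length := by
  rcases eq_or_ne k a with rfl | h
  · simp
  · rw [update_of_ne h]; exact Nat.zero_le _

/-- Mathlib's `Turing.initList` is the single-stack update of the empty stack assignment at the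
input stack `k₀`. [folklore] -/
theorem initList_eq (tm : FinTM2) (s : List (tm.Γ tm.k₀)) :
    initList tm s = ⟨some tm.main, tm.initialState, update (fun _ => []) tm.k₀ s⟩ := by
  unfold initList
  congr 1
  funext k
  by_cases h : k = tm.k₀
  · subst h; simp
  · rw [dif_neg h, update_of_ne h]

/-- Mathlib's `Turing.haltList` is the single-stack update of the empty stack assignment at the
output stack `k₁`. [folklore] -/
theorem haltList_eq (tm : FinTM2) (s : List (tm.Γ tm.k₁)) :
    haltList tm s = ⟨none, tm.initialState, update (fun _ => []) tm.k₁ s⟩ := by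
  unfold haltList
  congr 1
  funext k
  by_cases h : k = tm.k₁
  · subst h; simp
  · rw [dif_neg h, update_of_ne h]

end InitHalt

/-- **Output length bound.** A machine halting within `m` steps produces an output word of
length at most `l.length + D * m`, where `D = machinePushBound` bounds the pushes per step.
[folklore] -/
theorem length_le_of_outputsWithin {Γ₀ Γ₁ : Type} (M : TM2ComputableAux Γ₀ Γ₁) {l : List Γ₀}
    {l' : List Γ₁} {m : ℕ} (h : M.OutputsWithin l l' m) :
    l'.length ≤ l.length + machinePushBound M.tm * m := by
  obtain ⟨⟨⟨n, hn⟩, hnm⟩⟩ := h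
  have H := length_iterate_le M.tm M.tm.k₁ n _ _ hn
  rw [haltList_eq, initList_eq] at H
  simp only [update_self, List.length_map] at H
  have H' := length_update_bot_le (Γ := M.tm.Γ) M.tm.k₀ M.tm.k₁ (l.map M.inputAlphabet.symm)
  rw [List.length_map] at H'
  change n ≤ m at hnm
  exact H.trans (Nat.add_le_add H' (Nat.mul_le_mul_left _ hnm))


/-! ### The composite machine: stacks `K₁ ⊕ K₂`, labels `Λ₁ ⊕ Λ₂`, states `σ₁ × σ₂` -/

section Composite

variable {K₁ K₂ Λ₁ Λ₂ σ₁ σ₂ : Type} {G₁ : K₁ → Type} {G₂ : K₂ → Type}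

/-- Stack alphabets of the composite machine: those of `M₁` on the left summand, those of `M₂`
on the right summand (a reducible `Sum.elim G₁ G₂`, so that `CompΓ G₁ G₂ (inl k)` unfolds to
`G₁ k` by `rfl`). [folklore] -/
abbrev CompΓ (G₁ : K₁ → Type) (G₂ : K₂ → Type) : K₁ ⊕ K₂ → Type :=
  fun j => Sum.casesOn (motive := fun _ => Type) j G₁ G₂

/-- Translation of the statements of the first machine: act on the left stacks and the first
state component; `halt` is replaced by a jump to the main label `main₂` of the second machine.
[folklore] -/
def trStmt₁ (main₂ : Λ₂) :
    TM2.Stmt G₁ Λ₁ σ₁ → TM2.Stmt (CompΓ G₁ G₂) (Λ₁ ⊕ Λ₂) (σ₁ × σ₂)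
  | TM2.Stmt.push k f q => TM2.Stmt.push (Sum.inl k) (fun s => f s.1) (trStmt₁ main₂ q)
  | TM2.Stmt.peek k f q =>
      TM2.Stmt.peek (Sum.inl k) (fun s x => (f s.1 x, s.2)) (trStmt₁ main₂ q)
  | TM2.Stmt.pop k f q =>
      TM2.Stmt.pop (Sum.inl k) (fun s x => (f s.1 x, s.2)) (trStmt₁ main₂ q)
  | TM2.Stmt.load f q => TM2.Stmt.load (fun s => (f s.1, s.2)) (trStmt₁ main₂ q)
  | TM2.Stmt.branch p q₁ q₂ =>
      TM2.Stmt.branch (fun s => p s.1) (trStmt₁ main₂ q₁) (trStmt₁ main₂ q₂)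
  | TM2.Stmt.goto l => TM2.Stmt.goto (fun s => Sum.inl (l s.1))
  | TM2.Stmt.halt => TM2.Stmt.goto (fun _ => Sum.inr main₂)

/-- Stack contents of the composite machine while the first machine runs. [folklore] -/
def stk₁ (S : ∀ k, List (G₁ k)) : ∀ j : K₁ ⊕ K₂, List (CompΓ G₁ G₂ j)
  | Sum.inl k => S k
  | Sum.inr _ => []

/-- Configuration of the composite machine simulating a configuration of the first machine
(the halting label is sent to `main₂`). [folklore] -/
def cfg₁ (main₂ : Λ₂) (v₂ : σ₂) (c : TM2.Cfg G₁ Λ₁ σ₁) :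
    TM2.Cfg (CompΓ G₁ G₂) (Λ₁ ⊕ Λ₂) (σ₁ × σ₂) :=
  ⟨some (c.l.elim (Sum.inr main₂) Sum.inl), (c.var, v₂), stk₁ c.stk⟩

section Redirect

variable [DecidableEq K₂] (a₁ : K₁) (b₀ : K₂) (e : G₁ a₁ ≃ G₂ b₀)

/-- Redirection of the stacks of the second machine: its input stack `b₀` is identified with the
output stack `a₁` of the first machine (alphabets identified along `e`); every other stack `k`
is the right-summand stack `inr k`. Returns the composite stack index together with the
alphabet identification. [folklore] -/
def redirect (k : K₂) : Σ j : K₁ ⊕ K₂, (CompΓ G₁ G₂ j ≃ G₂ k) :=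
  if h : k = b₀ then ⟨Sum.inl a₁, e.trans (Equiv.cast (congrArg G₂ h.symm))⟩
  else ⟨Sum.inr k, Equiv.refl (G₂ k)⟩

/-- The input stack `b₀` of the second machine is redirected to the stack `inl a₁`, read through
`e`. [folklore] -/
theorem redirect_self : redirect a₁ b₀ e b₀ = ⟨Sum.inl a₁, e⟩ := by
  simp [redirect]

/-- Every stack `k ≠ b₀` of the second machine is the right-summand stack `inr k` (identity on
symbols). [folklore] -/
theorem redirect_of_ne {k : K₂} (h : k ≠ b₀) :
    redirect a₁ b₀ e k = ⟨Sum.inr k, Equiv.refl (G₂ k)⟩ := by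
  simp [redirect, h]

/-- Translation of the statements of the second machine: act on the redirected stacks and the
second state component. [folklore] -/
def trStmt₂ : TM2.Stmt G₂ Λ₂ σ₂ → TM2.Stmt (CompΓ G₁ G₂) (Λ₁ ⊕ Λ₂) (σ₁ × σ₂)
  | TM2.Stmt.push k f q =>
      TM2.Stmt.push (redirect a₁ b₀ e k).1 (fun s => (redirect a₁ b₀ e k).2.symm (f s.2))
        (trStmt₂ q)
  | TM2.Stmt.peek k f q =>
      TM2.Stmt.peek (redirect a₁ b₀ e k).1
        (fun s x => (s.1, f s.2 (x.map (redirect a₁ b₀ e k).2))) (trStmt₂ q)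
  | TM2.Stmt.pop k f q =>
      TM2.Stmt.pop (redirect a₁ b₀ e k).1
        (fun s x => (s.1, f s.2 (x.map (redirect a₁ b₀ e k).2))) (trStmt₂ q)
  | TM2.Stmt.load f q => TM2.Stmt.load (fun s => (s.1, f s.2)) (trStmt₂ q)
  | TM2.Stmt.branch p q₁ q₂ => TM2.Stmt.branch (fun s => p s.2) (trStmt₂ q₁) (trStmt₂ q₂)
  | TM2.Stmt.goto l => TM2.Stmt.goto (fun s => Sum.inr (l s.2))
  | TM2.Stmt.halt => TM2.Stmt.halt

/-- Stack contents of the composite machine while the second machine runs: the left stacks are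
empty except `a₁`, which holds (a copy along `e` of) the second machine's input stack; the right
stacks are those of the second machine, except that `inr b₀` is unused. [folklore] -/
def stk₂ [DecidableEq K₁] (S : ∀ k, List (G₂ k)) : ∀ j : K₁ ⊕ K₂, List (CompΓ G₁ G₂ j)
  | Sum.inl k => update (fun j => ([] : List (G₁ j))) a₁ ((S b₀).map e.symm) k
  | Sum.inr k => update S b₀ [] k

/-- Configuration of the composite machine simulating a configuration of the second machine.
[folklore] -/
def cfg₂ [DecidableEq K₁] (v₁ : σ₁) (c : TM2.Cfg G₂ Λ₂ σ₂) :
    TM2.Cfg (CompΓ G₁ G₂) (Λ₁ ⊕ Λ₂) (σ₁ × σ₂) :=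
  ⟨c.l.map Sum.inr, (v₁, c.var), stk₂ a₁ b₀ e c.stk⟩

end Redirect

variable [DecidableEq K₁] [DecidableEq K₂]

/-- Writing stack `k` of the first machine is writing stack `inl k` of the composite machine.
[folklore] -/
theorem stk₁_update (S : ∀ k, List (G₁ k)) (k : K₁) (L : List (G₁ k)) :
    update (stk₁ (G₂ := G₂) S) (Sum.inl k) L = stk₁ (update S k L) := by
  funext j
  rcases j with k' | k'
  · rcases eq_or_ne k' k with rfl | h
    · simp [stk₁]
    · rw [update_of_ne (by simpa using h)]; simp [stk₁, update_of_ne h]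
  · rw [update_of_ne (by simp)]; simp [stk₁]

/-- A single-stack assignment of the first machine embeds as the single-stack assignment at `inl k`.
[folklore] -/
theorem stk₁_update_bot (k : K₁) (L : List (G₁ k)) :
    stk₁ (G₂ := G₂) (update (fun j => ([] : List (G₁ j))) k L) =
      update (fun j => ([] : List (CompΓ G₁ G₂ j))) (Sum.inl k) L := by
  rw [← stk₁_update]
  congr 1
  funext j; rcases j with k' | k' <;> rfl

/-- One statement of the first machine is simulated exactly by its translation. [folklore] -/
theorem stepAux_trStmt₁ (main₂ : Λ₂) (v₂ : σ₂) (q : TM2.Stmt G₁ Λ₁ σ₁) (v : σ₁)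
    (S : ∀ k, List (G₁ k)) :
    TM2.stepAux (trStmt₁ (G₂ := G₂) main₂ q) (v, v₂) (stk₁ S) =
      cfg₁ main₂ v₂ (TM2.stepAux q v S) := by
  induction q generalizing v S with
  | push k f q ih =>
    simp only [trStmt₁, TM2.stepAux]
    rw [← ih]; congr 1
    exact stk₁_update S k (f v :: S k)
  | peek k f q ih => simp only [trStmt₁, TM2.stepAux]; exact ih _ _
  | pop k f q ih =>
    simp only [trStmt₁, TM2.stepAux]
    rw [← ih]; congr 1
    exact stk₁_update S k (S k).tail
  | load f q ih => simp only [trStmt₁, TM2.stepAux]; exact ih _ _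
  | branch p q₁ q₂ ih₁ ih₂ =>
    simp only [trStmt₁, TM2.stepAux]
    cases p v
    · exact ih₂ _ _
    · exact ih₁ _ _
  | goto l => rfl
  | halt => rfl

variable (a₁ : K₁) (b₀ : K₂) (e : G₁ a₁ ≃ G₂ b₀)

/-- Reading the redirected stack `k` of the second machine. [folklore] -/
theorem stk₂_redirect (S : ∀ k, List (G₂ k)) (k : K₂) :
    stk₂ a₁ b₀ e S (redirect a₁ b₀ e k).1 = (S k).map (redirect a₁ b₀ e k).2.symm := by
  rcases eq_or_ne k b₀ with rfl | h
  · rw [redirect_self]; simp only [stk₂, update_self]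
  · rw [redirect_of_ne a₁ b₀ e h]
    simp only [stk₂, update_of_ne h, Equiv.refl_symm, Equiv.coe_refl, List.map_id]

/-- Writing the redirected stack `k` of the second machine. [folklore] -/
theorem stk₂_update (S : ∀ k, List (G₂ k)) (k : K₂) (L : List (G₂ k)) :
    update (stk₂ a₁ b₀ e S) (redirect a₁ b₀ e k).1 (L.map (redirect a₁ b₀ e k).2.symm) =
      stk₂ a₁ b₀ e (update S k L) := by
  funext j
  rcases eq_or_ne k b₀ with rfl | h
  · rw [redirect_self]
    rcases j with k' | k'
    · rcases eq_or_ne k' a₁ with rfl | h'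
      · simp only [stk₂, update_self]
      · rw [update_of_ne (by simpa using h')]
        simp [stk₂, update_of_ne h']
    · rw [update_of_ne (by simp)]
      simp [stk₂]
  · rw [redirect_of_ne a₁ b₀ e h]
    rcases j with k' | k'
    · rw [update_of_ne (by simp)]
      simp [stk₂, update_of_ne (Ne.symm h)]
    · rcases eq_or_ne k' k with rfl | h'
      · simp only [stk₂, update_self, update_of_ne h, Equiv.refl_symm, Equiv.coe_refl,
          List.map_id]
      · rw [update_of_ne (by simpa using h')]
        rcases eq_or_ne k' b₀ with rfl | h''
        · simp [stk₂]
        · simp [stk₂, update_of_ne h', update_of_ne h'']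

/-- The empty stack assignment of the second machine embeds as the empty assignment of the composite
machine. [folklore] -/
theorem stk₂_bot : stk₂ a₁ b₀ e (fun j => ([] : List (G₂ j))) =
    fun j => ([] : List (CompΓ G₁ G₂ j)) := by
  funext j
  rcases j with k' | k'
  · simp [stk₂]
  · rcases eq_or_ne k' b₀ with rfl | h
    · simp [stk₂]
    · simp [stk₂, update_of_ne h]

/-- A single-stack assignment of the second machine embeds as the single-stack assignment at the
redirected stack. [folklore] -/
theorem stk₂_update_bot (k : K₂) (L : List (G₂ k)) :
    stk₂ a₁ b₀ e (update (fun j => ([] : List (G₂ j))) k L) =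
      update (fun j => ([] : List (CompΓ G₁ G₂ j))) (redirect a₁ b₀ e k).1
        (L.map (redirect a₁ b₀ e k).2.symm) := by
  rw [← stk₂_update, stk₂_bot]

/-- One statement of the second machine is simulated exactly by its translation. [folklore] -/
theorem stepAux_trStmt₂ (v₁ : σ₁) (q : TM2.Stmt G₂ Λ₂ σ₂) (v : σ₂) (S : ∀ k, List (G₂ k)) :
    TM2.stepAux (trStmt₂ (Λ₁ := Λ₁) a₁ b₀ e q) (v₁, v) (stk₂ a₁ b₀ e S) =
      cfg₂ a₁ b₀ e v₁ (TM2.stepAux q v S) := by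
  induction q generalizing v S with
  | push k f q ih =>
    simp only [trStmt₂, TM2.stepAux]
    rw [← ih, stk₂_redirect, ← List.map_cons, stk₂_update]
  | peek k f q ih =>
    simp only [trStmt₂, TM2.stepAux]
    rw [← ih, stk₂_redirect, List.head?_map, Option.map_map, Equiv.self_comp_symm, Option.map_id]
    rfl
  | pop k f q ih =>
    simp only [trStmt₂, TM2.stepAux]
    rw [← ih, stk₂_redirect, List.head?_map, Option.map_map, Equiv.self_comp_symm, Option.map_id,
      ← List.map_tail, stk₂_update]
    rfl
  | load f q ih => simp only [trStmt₂, TM2.stepAux]; exact ih _ _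
  | branch p q₁ q₂ ih₁ ih₂ =>
    simp only [trStmt₂, TM2.stepAux]
    cases p v
    · exact ih₂ _ _
    · exact ih₁ _ _
  | goto l => rfl
  | halt => rfl

end Composite


/-! ### Bundling: the composite `FinTM2` -/

section Bundled

variable (M₁ M₂ : FinTM2) (e : M₁.Γ M₁.k₁ ≃ M₂.Γ M₂.k₀)

/-- The composite of two bundled TM2 machines `M₁`, `M₂` along an identification `e` of the
output alphabet of `M₁` with the input alphabet of `M₂`: stacks `K₁ ⊕ K₂` (input stack
`inl k₀¹`, the input stack of `M₂` redirected onto the output stack `inl k₁¹` of `M₁`), labels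
`Λ₁ ⊕ Λ₂`, states `σ₁ × σ₂`; it runs `M₁`, jumps to `main₂` instead of halting, and runs `M₂`.
[cite: AroraBarak2009, §1.3] -/
def compTM : FinTM2 :=
  letI := M₁.kFin; letI := M₂.kFin; letI := M₁.ΛFin; letI := M₂.ΛFin
  letI := M₁.σFin; letI := M₂.σFin
  { K := M₁.K ⊕ M₂.K
    k₀ := Sum.inl M₁.k₀
    k₁ := (redirect M₁.k₁ M₂.k₀ e M₂.k₁).1
    Γ := CompΓ M₁.Γ M₂.Γ
    Λ := M₁.Λ ⊕ M₂.Λ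
    main := Sum.inl M₁.main
    σ := M₁.σ × M₂.σ
    initialState := (M₁.initialState, M₂.initialState)
    Γk₀Fin := M₁.Γk₀Fin
    m := fun l => match l with
      | Sum.inl l₁ => trStmt₁ M₂.main (M₁.m l₁)
      | Sum.inr l₂ => trStmt₂ M₁.k₁ M₂.k₀ e (M₂.m l₂) }

/-- Phase 1: a step of `M₁` is a step of the composite machine. [folklore] -/
theorem compTM_step_cfg₁ (c d : M₁.Cfg) (h : M₁.step c = some d) :
    (compTM M₁ M₂ e).step (cfg₁ M₂.main M₂.initialState c) =
      some (cfg₁ M₂.main M₂.initialState d) := by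
  obtain ⟨_ | l, v, S⟩ := c
  · simp [FinTM2.step, TM2.step] at h
  · simp only [FinTM2.step, TM2.step] at h
    obtain rfl := Option.some.inj h
    rw [← stepAux_trStmt₁]
    rfl

/-- Phase 2: a step of `M₂` is a step of the composite machine. [folklore] -/
theorem compTM_step_cfg₂ (c d : M₂.Cfg) (h : M₂.step c = some d) :
    (compTM M₁ M₂ e).step (cfg₂ M₁.k₁ M₂.k₀ e M₁.initialState c) =
      some (cfg₂ M₁.k₁ M₂.k₀ e M₁.initialState d) := by
  obtain ⟨_ | l, v, S⟩ := c
  · simp [FinTM2.step, TM2.step] at h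
  · simp only [FinTM2.step, TM2.step] at h
    obtain rfl := Option.some.inj h
    rw [← stepAux_trStmt₂]
    rfl

/-- Phase 1, iterated. [folklore] -/
theorem compTM_run₁ {n : ℕ} {c d : M₁.Cfg} (h : (flip bind M₁.step)^[n] (some c) = some d) :
    (flip bind (compTM M₁ M₂ e).step)^[n] (some (cfg₁ M₂.main M₂.initialState c)) =
      some (cfg₁ M₂.main M₂.initialState d) :=
  iterate_bind_map M₁.step (compTM M₁ M₂ e).step (cfg₁ M₂.main M₂.initialState)
    (compTM_step_cfg₁ M₁ M₂ e) n c d h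

/-- Phase 2, iterated. [folklore] -/
theorem compTM_run₂ {n : ℕ} {c d : M₂.Cfg} (h : (flip bind M₂.step)^[n] (some c) = some d) :
    (flip bind (compTM M₁ M₂ e).step)^[n] (some (cfg₂ M₁.k₁ M₂.k₀ e M₁.initialState c)) =
      some (cfg₂ M₁.k₁ M₂.k₀ e M₁.initialState d) :=
  iterate_bind_map M₂.step (compTM M₁ M₂ e).step (cfg₂ M₁.k₁ M₂.k₀ e M₁.initialState)
    (compTM_step_cfg₂ M₁ M₂ e) n c d h

/-- The initial configuration of `M₁` is simulated by the initial configuration of the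
composite machine. [folklore] -/
theorem cfg₁_initList (s : List (M₁.Γ M₁.k₀)) :
    cfg₁ M₂.main M₂.initialState (initList M₁ s) = initList (compTM M₁ M₂ e) s := by
  rw [initList_eq, initList_eq]
  simp only [cfg₁, Option.elim]
  congr 1
  exact stk₁_update_bot _ _

/-- The halting configuration of `M₁` with output `s` is simulated by the same configuration
as the initial configuration of `M₂` with input `s` (read through `e`). [folklore] -/
theorem cfg₁_haltList (s : List (M₁.Γ M₁.k₁)) :
    cfg₁ M₂.main M₂.initialState (haltList M₁ s) =
      cfg₂ M₁.k₁ M₂.k₀ e M₁.initialState (initList M₂ (s.map e)) := by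
  rw [haltList_eq, initList_eq]
  simp only [cfg₁, cfg₂, Option.elim, Option.map]
  congr 1
  rw [stk₁_update_bot, stk₂_update_bot, redirect_self]
  simp

/-- The halting configuration of `M₂` is simulated by the halting configuration of the
composite machine. [folklore] -/
theorem cfg₂_haltList (s : List (M₂.Γ M₂.k₁)) :
    cfg₂ M₁.k₁ M₂.k₀ e M₁.initialState (haltList M₂ s) =
      haltList (compTM M₁ M₂ e) (s.map (redirect M₁.k₁ M₂.k₀ e M₂.k₁).2.symm) := by
  rw [haltList_eq, haltList_eq]
  simp only [cfg₂, Option.map]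
  congr 1
  exact stk₂_update_bot _ _ _ _ _

end Bundled

end TM2Comp

end Literature.Computability.Complexity

/-! ### Composition of `TM2ComputableAux` machines (deliberate dot-notation extensions of
Mathlib's `Turing.TM2ComputableAux`, like `OutputsWithin` in `TimeBounds.lean`) -/

namespace Turing.TM2ComputableAux

open StateTransition Function Literature.Computability.Complexity.TM2Comp

variable {Γ₀ Γ₁ Γ₂ : Type}

/-- **Output length bound**: if `M` maps `l` to `l'` within `m` steps then
`l'.length ≤ l.length + D * m` with `D = machinePushBound M.tm` (each step pushes at most `D`
symbols on any stack). Dot-notation form of `TM2Comp.length_le_of_outputsWithin`. [folklore] -/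
theorem OutputsWithin.length_le {M : TM2ComputableAux Γ₀ Γ₁} {l : List Γ₀} {l' : List Γ₁}
    {m : ℕ} (h : M.OutputsWithin l l' m) :
    l'.length ≤ l.length + machinePushBound M.tm * m :=
  length_le_of_outputsWithin M h

/-- The sequential composite of `M₁ : TM2ComputableAux Γ₀ Γ₁` and `M₂ : TM2ComputableAux Γ₁ Γ₂`
(`TM2Comp.compTM` along `M₁.outputAlphabet.trans M₂.inputAlphabet.symm`; the second machine
reads the first machine's output stack in place). A deliberate dot-notation extension of
Mathlib's `Turing.TM2ComputableAux`. [Arora–Barak 2009, §1.3] [cite: AroraBarak2009, §1.3] -/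
def comp (M₁ : TM2ComputableAux Γ₀ Γ₁) (M₂ : TM2ComputableAux Γ₁ Γ₂) :
    TM2ComputableAux Γ₀ Γ₂ where
  tm := compTM M₁.tm M₂.tm (M₁.outputAlphabet.trans M₂.inputAlphabet.symm)
  inputAlphabet := M₁.inputAlphabet
  outputAlphabet :=
    (redirect M₁.tm.k₁ M₂.tm.k₀ (M₁.outputAlphabet.trans M₂.inputAlphabet.symm) M₂.tm.k₁).2.trans
      M₂.outputAlphabet

/-- **Sequential composition of TM2 machines, with additive running time.** If `M₁` maps the
word `l` to `l'` within `m₁` steps and `M₂` maps `l'` to `l''` within `m₂` steps, then the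
composite machine `M₁.comp M₂` maps `l` to `l''` within `m₂ + m₁` steps. This is the
machine-level content of Mathlib's `proof_wanted Turing.TM2ComputableInPolyTime.comp`.
[Arora–Barak 2009, §1.3 and proof of Thm. 2.8] [cite: AroraBarak2009, Thm. 2.8 (proof)] -/
theorem comp_outputsWithin (M₁ : TM2ComputableAux Γ₀ Γ₁) (M₂ : TM2ComputableAux Γ₁ Γ₂)
    {l : List Γ₀} {l' : List Γ₁} {l'' : List Γ₂} {m₁ m₂ : ℕ}
    (h₁ : M₁.OutputsWithin l l' m₁) (h₂ : M₂.OutputsWithin l' l'' m₂) :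
    (M₁.comp M₂).OutputsWithin l l'' (m₂ + m₁) := by
  obtain ⟨⟨⟨n₁, hn₁⟩, hnm₁⟩⟩ := h₁
  obtain ⟨⟨⟨n₂, hn₂⟩, hnm₂⟩⟩ := h₂
  change n₁ ≤ m₁ at hnm₁
  change n₂ ≤ m₂ at hnm₂
  refine ⟨⟨⟨n₂ + n₁, ?_⟩, Nat.add_le_add hnm₂ hnm₁⟩⟩
  set e := M₁.outputAlphabet.trans M₂.inputAlphabet.symm with he
  have H₁ := compTM_run₁ M₁.tm M₂.tm e hn₁
  have H₂ := compTM_run₂ M₁.tm M₂.tm e hn₂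
  rw [cfg₁_initList, cfg₁_haltList] at H₁
  rw [cfg₂_haltList, List.map_map] at H₂
  have hl' : (l'.map M₁.outputAlphabet.symm).map e = l'.map M₂.inputAlphabet.symm := by
    simp [he, List.map_map]
  rw [hl'] at H₁
  rw [Function.iterate_add_apply]
  exact (congrArg ((flip bind (compTM M₁.tm M₂.tm e).step)^[n₂]) H₁).trans H₂

end Turing.TM2ComputableAux

/-! ### Discharge of the named facts `TimeComputable.comp`, `PolyTimeComputable.comp` -/

namespace Literature.Computability.Complexity

open Turing Polynomial TM2Comp

variable {α β γ Γ₀ Γ₁ Γ₂ : Type}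

/-- **Discharge of `TimeComputable.comp`.** With the composite machine
`Turing.TM2ComputableAux.comp`, `g ∘ f` is computed in time `t₁ n + t₂ (s n)` (no copying
overhead: the second machine reads the first machine's output stack in place), which is at most
`1 * (t₁ n + t₂ (s n) + s n) + 1`; monotonicity of `t₂` and the length hypothesis `hs` bound the
second phase. [Arora–Barak 2009, §1.3] [cite: AroraBarak2009, §1.3] -/
theorem TimeComputable.comp_holds : @TimeComputable.comp α β γ Γ₀ Γ₁ Γ₂ := by
  intro ea eb ec f g t₁ t₂ s hg hf ht₂ hs
  obtain ⟨M₂, h₂⟩ := hg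
  obtain ⟨M₁, h₁⟩ := hf
  refine ⟨1, M₁.comp M₂, fun a => ?_⟩
  have H := TM2ComputableAux.comp_outputsWithin M₁ M₂ (h₁ a) (h₂ (f a))
  refine H.mono ?_
  have := ht₂ (hs a)
  simp only [one_mul]
  omega

/-- **Discharge of `PolyTimeComputable.comp`** (Mathlib's `proof_wanted
Turing.TM2ComputableInPolyTime.comp`): if `f` is computable in time `p₁` by `M₁` and `g` in
time `p₂` by `M₂`, then `g ∘ f` is computable by `M₁.comp M₂` in time
`p₂ (n + D * p₁ n) + p₁ n = (p₂.comp (X + C D * p₁) + p₁).eval n`, where `D = machinePushBound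
M₁.tm` bounds the length of the intermediate output (`OutputsWithin.length_le`) and `p₂.eval` is
monotone (proved inline) — "if `p`, `q` grow as `n^c`, `n^d` then `p(q(n))` grows as `n^{cd}`,
which is also polynomial … `f₂(f₁(x))` takes polynomial time to compute".
[Arora–Barak 2009, proof of Thm. 2.8, with the machine composition of §1.3]
[cite: AroraBarak2009, Thm. 2.8 (proof)] -/
theorem PolyTimeComputable.comp_holds : @PolyTimeComputable.comp α β γ Γ₀ Γ₁ Γ₂ := by
  intro ea eb ec f g hg hf
  obtain ⟨p₂, M₂, h₂⟩ := hg
  obtain ⟨p₁, M₁, h₁⟩ := hf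
  refine ⟨p₂.comp (X + C (machinePushBound M₁.tm) * p₁) + p₁, M₁.comp M₂, fun a => ?_⟩
  have H := TM2ComputableAux.comp_outputsWithin M₁ M₂ (h₁ a) (h₂ (f a))
  refine H.mono ?_
  have hlen := (h₁ a).length_le
  -- evaluation of an `ℕ`-polynomial is monotone in the argument
  have hmono : ∀ (p : Polynomial ℕ) {x y : ℕ}, x ≤ y → p.eval x ≤ p.eval y := by
    intro p x y hxy
    induction p using Polynomial.induction_on' with
    | add p q hp hq => simp only [eval_add]; exact Nat.add_le_add hp hq
    | monomial n c =>
      simp only [eval_monomial]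
      exact Nat.mul_le_mul_left c (Nat.pow_le_pow_left hxy n)
  simp only [eval_add, eval_comp, eval_mul, eval_C, eval_X]
  exact Nat.add_le_add_right (hmono p₂ hlen) _

/-- Corollary in Mathlib's bundled language: the statement of Mathlib's
`proof_wanted Turing.TM2ComputableInPolyTime.comp` (via `polyTimeComputable_iff_nonempty`).
[cite: AroraBarak2009, Thm. 2.8 (proof)] -/
theorem nonempty_tm2ComputableInPolyTime_comp {ea : α → List Γ₀} {eb : β → List Γ₁}
    {ec : γ → List Γ₂} {f : α → β} {g : β → γ} (h₁ : TM2ComputableInPolyTime ea eb f)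
    (h₂ : TM2ComputableInPolyTime eb ec g) :
    Nonempty (TM2ComputableInPolyTime ea ec (g ∘ f)) :=
  polyTimeComputable_iff_nonempty.1
    (PolyTimeComputable.comp_holds (polyTimeComputable_iff_nonempty.2 ⟨h₂⟩)
      (polyTimeComputable_iff_nonempty.2 ⟨h₁⟩))

end Literature.Computability.Complexity
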